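import Summits.RiemannHypothesis.RiemannHypothesis.Theorems.HandoffOffDiag
import Summits.RiemannHypothesis.RiemannHypothesis.Theorems.HandoffCouplingCumulative
import Summits.RiemannHypothesis.RiemannHypothesis.Theorems.HandoffTailDichotomy
import Summits.RiemannHypothesis.RiemannHypothesis.Theorems.HandoffEdgeLayer
import HarnessLib

/-!
# HANDOFF — the RESCUE / NO-HARM split of `H(q)`, and its exact logical status: BOTH halves are CUMULATIVE (cell rh-explicit, TRACK «HANDOFF», seat theory-2)

HONEST FRAMING. Nothing here proves or approaches RH; the content is one more NEGATIVE-STRUCTURAL theorem for the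
classification table HANDOFF-STATEMENT §I.5 («a per-window structural statement that yields RH via the handoff induction is
either cumulative or conditional-vacuous»). The handoff inequality `H(q) : deficit_q(g) ≤ contribution_q(g)` on the window of
the consecutive primes `q < q'` splits by the SIGN of the old form at the test function:

* `HandoffRescue q q'` — every test function at which the `{p < q}`-form is NEGATIVE (`deficit > 0`) is rescued by `q`;
* `HandoffNoHarm q q'` — the place `q` never turns a test function at which the `{p < q}`-form is NON-NEGATIVE (`deficit ≤ 0`)
  into a negative one: «the new prime only helps where help is needed».

`H(q) ↔ Rescue ∧ NoHarm` (`handoffH_iff_rescue_and_noHarm`). RESCUE is cumulative for the obvious reason (on the old cone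
`C((log q)/2)` the contribution vanishes, so Rescue there says «no negative vector»: `weilPositivityOn_of_handoffRescue`).
The point of this file is that NO-HARM — the natural «structural» candidate, silent about old-negative vectors — is
CUMULATIVE TOO: **`HandoffNoHarm q q' → WeilPositivityOn ((log q)/2)`** (`weilPositivityOn_of_handoffNoHarm`). Proof (the
overlap/line mechanism of §I.3, with the cross term computed): if `u₋ ∈ C((log q)/2)` had `Re Q(u₋) = α < 0`, translate it
flush to the left end `−t` of the window `t = (log q')/2` (the forms are translation invariant), so that its translate `u₁`
has mass in the LEFT edge layer; put a narrow bump `φ₀ = χ·u₁(· − log q)` in the RIGHT layer on top of the shifted copy of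
that mass; along the line `g_c = u₁ + c φ₀` one has `Re Q(g_c) = α + 2βc + Kc²` with `K = Re Q(φ₀) > 0` (Bombieri's lobe bound)
and `contribution_q(g_c) = −2 cap(q)·X₀·c` with `X₀ = ∫ χ|u₁(· − log q)|² > 0` (the spike at lag `log q` is the inner–edge
cross term alone), hence `deficit_q(g_c) = −(Kc² + 2(β + cap X₀)c + α)` has a root `c* > 0`; there the old form is exactly
`0` (non-negative) while `Re Q(g_{c*}) = −2 cap X₀ c* < 0` — NO-HARM fails. So `H(q) ⟹ NoHarm(q) ⟹ H(q⁻)`: sandwiched between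
consecutive rungs, `(∀ q, NoHarm) ⟺ RH`, and the TAIL form `∃ q₀ ∀ q ≥ q₀ NoHarm(q)` is already RH (`HandoffTailDichotomy`).

References: E. Bombieri, Rend. Mat. Acc. Lincei (9) 11 (2000) §3 (hermitian form), §12 Thm 12 (lobe bound) (`Bombieri2000Weil`);
A. Connes, C. Consani, Enseign. Math. 69 (2023) §2.3 («the contribution of the prime 2 first lowers the smallest eigenvalue …
but then saves it from being negative»; `ConnesConsani2023`).
-/

set_option linter.dupNamespace false  -- the mandated namespace repeats `RiemannHypothesis`

noncomputable section

open Set Filter Complex MeasureTheory Literature.NumberTheory.LFunctions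
open Summit.RiemannHypothesis.RiemannHypothesis.Theorems.Handoff
open Summit.RiemannHypothesis.RiemannHypothesis.Theorems.HandoffDecomposition
open scoped Real ComplexConjugate

namespace Summit.RiemannHypothesis.RiemannHypothesis.Theorems.HandoffNoHarm

variable {g u φ : ℝ → ℂ} {q q' : ℕ}

/-! ## §1  The two halves -/

/-- **RESCUE(q)**: on the window of `q < q'`, every test function at which the `{p < q}`-form is NEGATIVE is rescued by
the place `q` (`0 < deficit → deficit ≤ contribution`). A statement of THIS track. [this track, HANDOFF-STATEMENT §I.5 (classification)] -/
def HandoffRescue (q q' : ℕ) : Prop :=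
  ∀ b ∈ Icc (Real.log q / 2) (Real.log q' / 2), ∀ g : ℝ → ℂ, IsWeilTest g → tsupport g ⊆ Icc (-b) b →
    0 < deficit q g → deficit q g ≤ contribution q g

/-- **NO-HARM(q)**: on the window of `q < q'`, the place `q` never makes a test function at which the `{p < q}`-form is
NON-NEGATIVE into a negative one (`deficit ≤ 0 → deficit ≤ contribution`, i.e. `Re Q_{S_q}(g) ≥ 0 → Re Q(g) ≥ 0`).
A statement of THIS track. [this track, HANDOFF-STATEMENT §I.5 (classification)] -/
def HandoffNoHarm (q q' : ℕ) : Prop :=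
  ∀ b ∈ Icc (Real.log q / 2) (Real.log q' / 2), ∀ g : ℝ → ℂ, IsWeilTest g → tsupport g ⊆ Icc (-b) b →
    deficit q g ≤ 0 → deficit q g ≤ contribution q g

/-- `H(q) ↔ Rescue(q) ∧ NoHarm(q)` (case split on the sign of the deficit). [folklore] -/
theorem handoffH_iff_rescue_and_noHarm : HandoffH q q' ↔ HandoffRescue q q' ∧ HandoffNoHarm q q' := by
  constructor
  · intro H
    exact ⟨fun b hb g hg hs _ ↦ H b hb g hg hs, fun b hb g hg hs _ ↦ H b hb g hg hs⟩
  · rintro ⟨hR, hN⟩ b hb g hg hs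
    rcases le_or_gt (deficit q g) 0 with h0 | h0
    · exact hN b hb g hg hs h0
    · exact hR b hb g hg hs h0

/-- `H(q) → NoHarm(q)`. [folklore] -/
theorem handoffNoHarm_of_handoffH (H : HandoffH q q') : HandoffNoHarm q q' := (handoffH_iff_rescue_and_noHarm.1 H).2

/-- `H(q) → Rescue(q)`. [folklore] -/
theorem handoffRescue_of_handoffH (H : HandoffH q q') : HandoffRescue q q' := (handoffH_iff_rescue_and_noHarm.1 H).1

/-- **RESCUE is cumulative**: `Rescue(q) → WeilPositivityOn((log q)/2)` — on the old cone the contribution of `q` vanishes,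
so a negative vector there would have positive deficit and zero contribution. [folklore] -/
theorem weilPositivityOn_of_handoffRescue (h : ConsecutivePrimes q q') (hR : HandoffRescue q q') :
    WeilPositivityOn (Real.log q / 2) := by
  intro u hu hus
  have hqq' : Real.log q / 2 ≤ Real.log q' / 2 := by
    have : (q : ℝ) ≤ q' := by exact_mod_cast h.2.2.1.le
    have hq : (0 : ℝ) < q := by exact_mod_cast h.1.pos
    linarith [Real.log_le_log hq this]
  have hc0 : contribution q u = 0 := contribution_eq_zero_of_narrow hu hus
  have hid := re_weilQuadratic_eq_contribution_sub_deficit h hu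
    (hus.trans (Icc_subset_Icc (neg_le_neg hqq') hqq'))
  by_contra hneg
  have hd : 0 < deficit q u := by linarith [not_le.1 hneg]
  have := hR (Real.log q / 2) ⟨le_rfl, hqq'⟩ u hu hus hd
  linarith

/-! ## §2  Kernel bookkeeping at lag `log q` -/

/-- A narrow kernel vanishes at a large lag: `tsupport f ⊆ [a, b]`, `b − a < L` ⇒ `(f ⋆ f̃)(L) = 0`. [folklore] -/
theorem weilConv_weilReflect_apply_eq_zero_of_narrow (f : ℝ → ℂ) {a b L : ℝ} (hf : tsupport f ⊆ Icc a b)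
    (hL : b - a < L) : weilConv f (weilReflect f) L = 0 := by
  rw [weilConv_apply]
  refine integral_eq_zero_of_ae (Eventually.of_forall fun x ↦ ?_)
  by_cases h1 : f x = 0
  · simp [h1]
  by_cases h2 : f (x - L) = 0
  · simp [weilReflect, neg_sub, h2]
  have hx := hf (subset_tsupport _ (Function.mem_support.2 h1))
  have hx' := hf (subset_tsupport _ (Function.mem_support.2 h2))
  exfalso
  linarith [hx.2, hx'.1]

/-- A cross kernel vanishes at a lag exceeding the gap between the supports:
`tsupport u ⊆ [a, b]`, `tsupport φ ⊆ [a', b']`, `b < a' + L` ⇒ `(u ⋆ φ̃)(L) = 0`. [folklore] -/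
theorem weilConv_weilReflect_cross_eq_zero (u φ : ℝ → ℂ) {a b a' b' L : ℝ} (hu : tsupport u ⊆ Icc a b)
    (hφ : tsupport φ ⊆ Icc a' b') (hL : b < a' + L) : weilConv u (weilReflect φ) L = 0 := by
  rw [weilConv_apply]
  refine integral_eq_zero_of_ae (Eventually.of_forall fun x ↦ ?_)
  by_cases h1 : u x = 0
  · simp [h1]
  by_cases h2 : φ (x - L) = 0
  · simp [weilReflect, neg_sub, h2]
  have hx := hu (subset_tsupport _ (Function.mem_support.2 h1))
  have hx' := hφ (subset_tsupport _ (Function.mem_support.2 h2))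
  exfalso
  linarith [hx.2, hx'.1]

/-- The cross kernel of `φ = χ·v(· − L)` against `v` at lag `L` is the χ-weighted mass of `v`:
`(φ ⋆ ṽ)(L) = ∫ χ(x) |v(x − L)|² dx`. [folklore] -/
theorem weilConv_weilReflect_bump_mul_translate (χ : ℝ → ℝ) (v : ℝ → ℂ) (L : ℝ) :
    weilConv (fun x ↦ (χ x : ℂ) * v (x - L)) (weilReflect v) L =
      ((∫ x : ℝ, χ x * ‖v (x - L)‖ ^ 2 : ℝ) : ℂ) := by
  rw [weilConv_apply, ← integral_complex_ofReal]
  congr 1 with x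
  simp only [weilReflect, neg_sub]
  rw [mul_assoc, Complex.mul_conj, Complex.normSq_eq_norm_sq]
  push_cast
  ring

/-! ## §3  NO-HARM is cumulative -/

/-- **The line construction.** For consecutive primes `q < q'`, `t = (log q')/2`, `L = log q`: let `u, φ` be Weil test functions on
`[−t, t]` with `(u ⋆ ũ)(L) = 0`, `tsupport φ ⊆ [a, b] ⊆ [−t, t]`, `b − a < L`, `t < a + L`, `0 < Re Q(φ)`, `(φ ⋆ ũ)(L) = X₀ > 0`
(real) and `Re Q(u) < 0`. Then some `g = u + c φ`, `c > 0`, on the window has `deficit_q(g) = 0` and `contribution_q(g) < 0`.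
[this track; Bombieri2000Weil §3 (the form along a real line)] -/
theorem exists_deficit_eq_zero_contribution_neg (h : ConsecutivePrimes q q') (hu : IsWeilTest u) (hφ : IsWeilTest φ)
    {a b X₀ : ℝ} (hus : tsupport u ⊆ Icc (-(Real.log q' / 2)) (Real.log q' / 2))
    (hφs : tsupport φ ⊆ Icc a b) (hab : Icc a b ⊆ Icc (-(Real.log q' / 2)) (Real.log q' / 2))
    (hba : b - a < Real.log q) (hta : Real.log q' / 2 < a + Real.log q)
    (hkuu : weilConv u (weilReflect u) (Real.log q) = 0)
    (hX : weilConv φ (weilReflect u) (Real.log q) = (X₀ : ℂ)) (hX₀ : 0 < X₀)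
    (hK : 0 < (weilQuadratic φ).re) (hα : (weilQuadratic u).re < 0) :
    ∃ g : ℝ → ℂ, IsWeilTest g ∧ tsupport g ⊆ Icc (-(Real.log q' / 2)) (Real.log q' / 2) ∧
      deficit q g = 0 ∧ contribution q g < 0 := by
  set L : ℝ := Real.log q with hL
  set t : ℝ := Real.log q' / 2 with ht
  set α : ℝ := (weilQuadratic u).re with hα_def
  set β : ℝ := crossRe u φ with hβ
  set K : ℝ := (weilQuadratic φ).re with hK_def
  set cap : ℝ := Real.log q / Real.sqrt q with hcap
  have hcap_pos : 0 < cap := by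
    have hq1 : (1 : ℝ) < q := by exact_mod_cast h.1.one_lt
    exact div_pos (Real.log_pos hq1) (Real.sqrt_pos.2 (by linarith))
  -- the kernel of g_c = u + c φ at lag L is c·X₀
  have hkφφ : weilConv φ (weilReflect φ) L = 0 := weilConv_weilReflect_apply_eq_zero_of_narrow φ hφs hba
  have hkuφ : weilConv u (weilReflect φ) L = 0 :=
    weilConv_weilReflect_cross_eq_zero u φ hus hφs (by linarith)
  have hkernel : ∀ c : ℝ,
      weilConv (u + fun x ↦ (c : ℂ) * φ x) (weilReflect (u + fun x ↦ (c : ℂ) * φ x)) L = (c : ℂ) * X₀ := by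
    intro c
    have hcφ : IsWeilTest (fun x ↦ (c : ℂ) * φ x) := hφ.const_mul (c : ℂ)
    have e := congrFun (weilConv_weilReflect_add hu hcφ) L
    simp only [Pi.add_apply] at e
    rw [e, weilReflect_const_mul, weilConv_const_mul_left, weilConv_const_mul_right, weilConv_const_mul_right,
      weilConv_const_mul_left]
    simp only [Complex.conj_ofReal]
    rw [hkuu, hkφφ, hkuφ, hX]
    ring
  have hcontrib : ∀ c : ℝ, contribution q (u + fun x ↦ (c : ℂ) * φ x) = -(2 * cap * X₀ * c) := by
    intro c
    rw [contribution_eq_two_mul, hkernel c]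
    simp only [Complex.mul_re, Complex.ofReal_re, Complex.ofReal_im, mul_zero, sub_zero]
    rw [hcap]; ring
  have hReQ : ∀ c : ℝ, (weilQuadratic (u + fun x ↦ (c : ℂ) * φ x)).re = α + 2 * β * c + K * c ^ 2 :=
    fun c ↦ re_weilQuadratic_add_real_mul hu hφ c
  have hgt : ∀ c : ℝ, IsWeilTest (u + fun x ↦ (c : ℂ) * φ x) := fun c ↦ hu.add (hφ.const_mul (c : ℂ))
  have hgs : ∀ c : ℝ, tsupport (u + fun x ↦ (c : ℂ) * φ x) ⊆ Icc (-t) t := by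
    intro c
    refine (tsupport_add _ _).trans (union_subset hus ?_)
    exact tsupport_mul_subset_right.trans (hφs.trans hab)
  -- deficit along the line: deficit = contribution − Re Q = −(K c² + 2(β + cap X₀) c + α)
  have hdef : ∀ c : ℝ, deficit q (u + fun x ↦ (c : ℂ) * φ x) = -(K * c ^ 2 + 2 * (β + cap * X₀) * c + α) := by
    intro c
    have hid := re_weilQuadratic_eq_contribution_sub_deficit h (hgt c) (hgs c)
    rw [hReQ c, hcontrib c] at hid
    linarith
  -- the positive root of K c² + B c + α, B = 2(β + cap X₀)
  set B : ℝ := 2 * (β + cap * X₀) with hB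
  set D : ℝ := B ^ 2 - 4 * K * α with hD
  have hDpos : 0 < D := by nlinarith [sq_nonneg B, mul_pos hK (neg_pos.2 hα)]
  set s : ℝ := Real.sqrt D with hs
  have hs_sq : s * s = D := Real.mul_self_sqrt hDpos.le
  have hsB : |B| < s := by
    rw [← Real.sqrt_sq_eq_abs, hs]
    exact Real.sqrt_lt_sqrt (sq_nonneg B) (by nlinarith [mul_pos hK (neg_pos.2 hα)])
  set cstar : ℝ := (-B + s) / (2 * K) with hcstar
  have hcstar_pos : 0 < cstar := div_pos (by linarith [neg_abs_le B, le_abs_self B]) (by linarith)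
  have hroot : K * cstar ^ 2 + B * cstar + α = 0 := by
    have hq := (quadratic_eq_zero_iff hK.ne' (by rw [discrim, hs_sq, hD]) cstar).2 (Or.inl rfl)
    rw [show K * cstar ^ 2 = K * (cstar * cstar) by ring]
    exact hq
  refine ⟨u + fun x ↦ (cstar : ℂ) * φ x, hgt cstar, hgs cstar, ?_, ?_⟩
  · rw [hdef cstar]
    have : K * cstar ^ 2 + 2 * (β + cap * X₀) * cstar + α = 0 := hroot
    linarith
  · rw [hcontrib cstar]
    have : 0 < 2 * cap * X₀ * cstar := by positivity
    linarith

/-- **NO-HARM IS CUMULATIVE: `HandoffNoHarm q q' → WeilPositivityOn ((log q)/2)`** for consecutive primes `q < q'`.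
See the module docstring for the construction (translate a hypothetical negative old-cone vector flush left, add a narrow bump on
the shifted copy of its left-edge mass in the right edge layer, move along the line until the old form vanishes exactly).
[this track (theory-2 gen3); Bombieri2000Weil §3, §12 Thm 12] -/
theorem weilPositivityOn_of_handoffNoHarm (h : ConsecutivePrimes q q') (hN : HandoffNoHarm q q') :
    WeilPositivityOn (Real.log q / 2) := by
  intro u₀ hu₀ hu₀s
  by_contra hneg
  have hα : (weilQuadratic u₀).re < 0 := not_le.1 hneg
  set L : ℝ := Real.log q with hL
  set t : ℝ := Real.log q' / 2 with ht
  have hq1 : (1 : ℝ) < q := by exact_mod_cast h.1.one_lt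
  have hL0 : 0 < L := Real.log_pos hq1
  have hLt : L / 2 < t := by
    have hq0 : (0 : ℝ) < q := by linarith
    have hlt : Real.log q < Real.log q' := Real.log_lt_log hq0 (by exact_mod_cast h.2.2.1)
    rw [hL, ht]; linarith
  have htL : t < L := h.log_half_lt_log
  have hlog2 : Real.log 2 ≤ L := Real.log_le_log two_pos (by exact_mod_cast h.1.two_le)
  have hne : (tsupport u₀).Nonempty := by
    by_contra hempty
    rw [not_nonempty_iff_eq_empty, tsupport_eq_empty_iff] at hempty
    rw [hempty, weilQuadratic_zero, Complex.zero_re] at hα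
    exact lt_irrefl _ hα
  have hcpt : IsCompact (tsupport u₀) := hu₀.2
  set m : ℝ := sInf (tsupport u₀) with hm
  have hm_mem : m ∈ tsupport u₀ := hcpt.sInf_mem hne
  have hm_le : ∀ x ∈ tsupport u₀, m ≤ x := fun x hx ↦ csInf_le hcpt.bddBelow hx
  have hmL : -(L / 2) ≤ m := by have := (hu₀s hm_mem).1; rw [hL]; linarith
  have hML : ∀ x ∈ tsupport u₀, x ≤ L / 2 := fun x hx ↦ by have := (hu₀s hx).2; rw [hL]; linarith
  set δ : ℝ := t - L / 2 with hδ
  have hδ0 : 0 < δ := by rw [hδ]; linarith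
  obtain ⟨y₀, hy₀s, hy₀d⟩ := Metric.mem_closure_iff.1 (by simpa [tsupport] using hm_mem) δ hδ0
  have hy₀ne : u₀ y₀ ≠ 0 := Function.mem_support.1 hy₀s
  have hmy₀ : m ≤ y₀ := hm_le y₀ (subset_tsupport _ hy₀s)
  have hy₀m : y₀ < m + δ := by
    rw [Real.dist_eq] at hy₀d
    linarith [le_abs_self (m - y₀), neg_abs_le (m - y₀)]
  -- the flush-left translate u₁(x) = u₀(x − s), s = −(t + m)
  set s : ℝ := -(t + m) with hs
  set u₁ : ℝ → ℂ := fun x ↦ u₀ (x - s) with hu₁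
  have hu₁t : IsWeilTest u₁ := by
    have e : u₁ = fun x ↦ u₀ (x + (t + m)) := by
      funext x; simp only [hu₁, hs, sub_neg_eq_add]
    rw [e]
    exact isWeilTest_recentre hu₀ (t + m)
  have hu₁s : tsupport u₁ ⊆ Icc (-t) t := by
    intro x hx
    have hx' : x - s ∈ tsupport u₀ :=
      tsupport_comp_subset_preimage_of_continuous u₀ (continuous_id.sub continuous_const) hx
    have h1 := hm_le _ hx'
    have h2 := hML _ hx'
    rw [hs] at h1 h2
    constructor <;> linarith
  have hku₁ : weilConv u₁ (weilReflect u₁) L = 0 := by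
    rw [hu₁, Handoff.weilConv_weilReflect_translate u₀ s, show L = 2 * (L / 2) by ring]
    exact weilConv_weilReflect_self_apply_two_mul (u := u₀) hu₀s
  have hQu₁ : (weilQuadratic u₁).re < 0 := by rw [hu₁, Handoff.weilQuadratic_translate u₀ s]; exact hα
  set x₁ : ℝ := y₀ + s + L with hx₁
  have hu₁x₁ : u₁ (x₁ - L) = u₀ y₀ := by
    simp only [hu₁, hx₁]
    congr 1; ring
  set r : ℝ := min (min (δ / 2) (Real.exp (-12) / 2)) ((L - t) / 2) with hr
  have hr0 : 0 < r := lt_min (lt_min (by linarith) (by positivity)) (by linarith)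
  have hrδ : r ≤ δ / 2 := (min_le_left _ _).trans (min_le_left _ _)
  have hre : r ≤ Real.exp (-12) / 2 := (min_le_left _ _).trans (min_le_right _ _)
  have hrLt : r ≤ (L - t) / 2 := min_le_right _ _
  have hexp : Real.exp (-12) < Real.log 2 := exp_neg_twelve_lt_log_two
  have hx₁r : x₁ + r ≤ t := by
    simp only [hx₁, hs]
    linarith [hy₀m, hrδ, hLt, hδ]
  have hx₁l : -t ≤ x₁ - r := by
    simp only [hx₁, hs]
    linarith [hmy₀, hre, hexp, hlog2]
  have hcross : t < x₁ - r + L := by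
    simp only [hx₁, hs]
    linarith [hmy₀, hrLt, htL]
  let χ : ContDiffBump x₁ := ⟨r / 2, r, by positivity, by linarith⟩
  have hχr : χ.rOut = r := rfl
  set φ₀ : ℝ → ℂ := fun x ↦ ((χ x : ℝ) : ℂ) * u₁ (x - L) with hφ₀
  have hχt : IsWeilTest (fun x ↦ ((χ x : ℝ) : ℂ)) :=
    ⟨Complex.ofRealCLM.contDiff.comp χ.contDiff,
      (χ.hasCompactSupport.comp_left Complex.ofReal_zero : HasCompactSupport ((fun r : ℝ ↦ (r : ℂ)) ∘ χ))⟩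
  have hshift : IsWeilTest (fun x ↦ u₁ (x - L)) := by
    have e : (fun x ↦ u₁ (x - L)) = fun x ↦ u₁ (x + -L) := by
      funext x; simp only [← sub_eq_add_neg]
    rw [e]
    exact isWeilTest_recentre hu₁t (-L)
  have hφ₀t : IsWeilTest φ₀ := ⟨hχt.1.mul hshift.1, hχt.2.mul_right⟩
  have hχs : tsupport (fun x ↦ ((χ x : ℝ) : ℂ)) ⊆ Icc (x₁ - r) (x₁ + r) := by
    refine (tsupport_comp_subset Complex.ofReal_zero _).trans ?_
    rw [χ.tsupport_eq, Real.closedBall_eq_Icc, hχr]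
  have hφ₀s : tsupport φ₀ ⊆ Icc (x₁ - r) (x₁ + r) :=
    (tsupport_mul_subset_left (f := fun x ↦ ((χ x : ℝ) : ℂ)) (g := fun x ↦ u₁ (x - L))).trans hχs
  have hab : Icc (x₁ - r) (x₁ + r) ⊆ Icc (-t) t := Icc_subset_Icc hx₁l hx₁r
  -- K = Re Q(φ₀) > 0 (Bombieri's lobe bound on a support of width 2r ≤ e^{-12})
  have hχx₁ : χ x₁ = 1 := χ.one_of_mem_closedBall (Metric.mem_closedBall_self (by positivity))
  have hφ₀x₁ : φ₀ x₁ ≠ 0 := by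
    simp only [hφ₀]
    rw [hu₁x₁, hχx₁]
    simpa using hy₀ne
  have hmass : 0 < ∫ x : ℝ, ‖φ₀ x‖ ^ 2 :=
    integral_pos_of_integrable_nonneg_nonzero ((hφ₀t.1.continuous.norm).pow 2) hφ₀t.integrable_norm_sq
      (fun _ ↦ by positivity) (pow_ne_zero 2 (norm_ne_zero_iff.2 hφ₀x₁))
  have hK : 0 < (weilQuadratic φ₀).re := by
    have hge := re_weilQuadratic_lobe_ge hφ₀t (c := x₁ - r) (d := x₁ + r) (by linarith) (by linarith) hφ₀s
    rw [show x₁ + r - (x₁ - r) = 2 * r by ring] at hge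
    exact lt_of_lt_of_le (mul_pos (lobe_coeff_pos (D := 2 * r) (by linarith) (by linarith)) hmass) hge
  -- X₀ = ∫ χ |u₁(· − L)|² > 0
  set X₀ : ℝ := ∫ x : ℝ, χ x * ‖u₁ (x - L)‖ ^ 2 with hX₀
  have hX : weilConv φ₀ (weilReflect u₁) L = (X₀ : ℂ) := weilConv_weilReflect_bump_mul_translate χ u₁ L
  have hX₀pos : 0 < X₀ := by
    have hcont : Continuous fun x : ℝ ↦ χ x * ‖u₁ (x - L)‖ ^ 2 :=
      χ.continuous.mul ((hshift.1.continuous.norm).pow 2)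
    have hint : Integrable fun x : ℝ ↦ χ x * ‖u₁ (x - L)‖ ^ 2 :=
      hcont.integrable_of_hasCompactSupport χ.hasCompactSupport.mul_right
    have hnn : 0 ≤ fun x : ℝ ↦ χ x * ‖u₁ (x - L)‖ ^ 2 := fun x ↦ mul_nonneg (χ.nonneg' x) (by positivity)
    have hx₁ne : χ x₁ * ‖u₁ (x₁ - L)‖ ^ 2 ≠ 0 := by
      rw [hu₁x₁, hχx₁, one_mul]
      exact pow_ne_zero 2 (norm_ne_zero_iff.2 hy₀ne)
    rw [hX₀]
    exact integral_pos_of_integrable_nonneg_nonzero hcont hint hnn hx₁ne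
  -- the line construction gives a test function with deficit 0 and negative contribution: NO-HARM fails
  have hba : x₁ + r - (x₁ - r) < Real.log q := by rw [← hL]; linarith
  have hta : Real.log q' / 2 < x₁ - r + Real.log q := by rw [← hL, ← ht]; exact hcross
  obtain ⟨g, hg, hgs, hd0, hc0⟩ := exists_deficit_eq_zero_contribution_neg h hu₁t hφ₀t hu₁s hφ₀s hab
    hba hta hku₁ hX hX₀pos hK hQu₁
  have hle : Real.log q / 2 ≤ Real.log q' / 2 := by rw [← ht, ← hL]; linarith
  have := hN (Real.log q' / 2) ⟨hle, le_rfl⟩ g hg hgs hd0.le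
  linarith

/-! ## §4  Consequences: the sandwich, `RH ↔ ∀ NoHarm`, and the tail form -/

/-- **The sandwich** `WeilPositivityOn((log q')/2) → NoHarm(q) → WeilPositivityOn((log q)/2)`: the no-harm law of `q` is
pinned between two consecutive rungs of Weil positivity. [this track] -/
theorem handoffNoHarm_sandwich (h : ConsecutivePrimes q q') :
    (WeilPositivityOn (Real.log q' / 2) → HandoffNoHarm q q') ∧
      (HandoffNoHarm q q' → WeilPositivityOn (Real.log q / 2)) :=
  ⟨fun hW ↦ handoffNoHarm_of_handoffH ((handoffH_iff_weilPositivityOn h).2 hW), weilPositivityOn_of_handoffNoHarm h⟩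

/-- **`RH ↔ ∀ consecutive primes, NoHarm(q)`** — no discount: «the new prime never hurts an old-positive function» for
every `q` is Weil positivity on every window. [cite: Bombieri2000Weil, Thm 2 (p. 193); this track] -/
theorem riemannHypothesis_iff_forall_handoffNoHarm :
    Summit.RiemannHypothesis ↔ ∀ q q' : ℕ, ConsecutivePrimes q q' → HandoffNoHarm q q' := by
  rw [Summit.RiemannHypothesis_iff]
  constructor
  · intro hRH q q' hqq'
    exact handoffNoHarm_of_handoffH ((Handoff.riemannHypothesis_iff_forall_handoffH.1 hRH) q q' hqq')
  · intro hN
    rw [riemannHypothesis_iff_forall_weilPositivityOn]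
    intro a ha
    obtain ⟨p, hpa, hp⟩ := Nat.exists_infinite_primes (⌈Real.exp (2 * a)⌉₊ + 2)
    have hW := weilPositivityOn_of_handoffNoHarm (consecutivePrimes_nextPrime hp)
      (hN p _ (consecutivePrimes_nextPrime hp))
    refine hW.mono ?_
    have h1 : Real.exp (2 * a) ≤ p := by
      have h0 : ⌈Real.exp (2 * a)⌉₊ ≤ p := by omega
      have : (⌈Real.exp (2 * a)⌉₊ : ℝ) ≤ p := by exact_mod_cast h0
      exact (Nat.le_ceil _).trans this
    have h2 := Real.log_le_log (Real.exp_pos _) h1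
    rw [Real.log_exp] at h2
    linarith

/-- **The TAIL form is already RH**: `RH ↔ ∃ q₀, ∀ primes q ≥ q₀, NoHarm(q, q⁺)` (cumulativity + `HandoffTailDichotomy`).
[this track] -/
theorem riemannHypothesis_iff_exists_forall_handoffNoHarm :
    Summit.RiemannHypothesis ↔ ∃ q₀ : ℕ, ∀ q : ℕ, q.Prime → q₀ ≤ q → HandoffNoHarm q (nextPrime q) := by
  refine riemannHypothesis_iff_exists_forall_of_cumulative (X := fun q ↦ HandoffNoHarm q (nextPrime q)) ?_ ?_
  · intro hRH q hq
    exact handoffNoHarm_of_handoffH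
      ((Handoff.riemannHypothesis_iff_forall_handoffH.1 (Summit.RiemannHypothesis_iff.1 hRH)) q _
        (consecutivePrimes_nextPrime hq))
  · intro q hq hX
    exact weilPositivityOn_of_handoffNoHarm (consecutivePrimes_nextPrime hq) hX

end Summit.RiemannHypothesis.RiemannHypothesis.Theorems.HandoffNoHarm

end
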